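import Literature.Probability.RandomPlanarGeometry.ChordalRestrictionMarkov
import HarnessLib

/-!
# The restriction-kernel clause: bookkeeping from an a.e. clause to `IsRestrictionMarkov`

Crux `AxiomsOfLimit` (stmt-CriticalPhenomena-1370), line `registered`, stub `stub_markovOfLimit`
(lead c5). Theorems only.

The Markov conjunct (ii) of the crux is `P.IsRestrictionMarkov = ∃ Q, P.IsMarkovExtension Q ∧
P.IsRestrictionKernel Q`, where the kernel clause `IsRestrictionKernel` is quantified over ALL
Dobrushin domains `D`, ALL pasts `p` and all pinned Dobrushin sub-domains `D'` of the remaining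
domain. This file proves that it suffices to know the clause ALMOST EVERYWHERE: if `P` has the
two-sided restriction property (conjunct (i)), `Q` is a Markov extension of `P`, and for every
Dobrushin domain `D` and every closed `F` the clause holds at the past `γ.stopAt F` for
`P D`-a.e. `γ`, then `P.IsRestrictionMarkov`.

Proof: replace `Q D p` by `0` at the configurations where the clause fails. The clause at `(D, p)`
and the value `Q D p` depend on `(D, p)` only through the configuration
`(remainingDomain D p, p.target, D.pt 1)` (`IsMarkovExtension.domain`), so the modified kernel still
satisfies `domain`; at the trivial past the clause IS the restriction property (i)
(`remainingDomain_mk_const`), so `initial` is untouched; the modification happens on a set of pasts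
that is null for every `(D, F)`, so `markov` is untouched; and where the kernel was zeroed the
clause reads `0 = 0`.

References: W. Werner, *Lectures on two-dimensional critical percolation* (2007) §3.2 (2);
G. F. Lawler, O. Schramm, W. Werner, *Conformal restriction: the chordal case* (2003) §1, §3.
All [folklore].
-/

noncomputable section

open MeasureTheory Set
open scoped ENNReal

namespace Summit.CriticalPhenomena.SAWScalingLimit.Theorems.AxiomsOfLimitKernelClause

open Literature.Probability.RandomPlanarGeometry

/-- **The kernel clause on a null conditioning event is trivial**: if `ν {γ ⊆ D̄'} = 0` then
`μ T · ν {γ ⊆ D̄'} = ν (T ∩ {γ ⊆ D̄'})` for every `T` (both sides vanish). [folklore] -/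
theorem kernelClause_of_measure_eq_zero (μ ν : Measure (CurveClass ℂ)) (D' : DobrushinDomain)
    (h0 : ν (CurveClass.rangeSubset (closure D'.carrier)) = 0) (T : Set (CurveClass ℂ)) :
    μ T * ν (CurveClass.rangeSubset (closure D'.carrier)) =
      ν (T ∩ CurveClass.rangeSubset (closure D'.carrier)) := by
  rw [h0, mul_zero]
  exact (measure_mono_null inter_subset_right h0).symm

/-- **The kernel clause at the trivial past is the restriction property (i).** If `P` has the
two-sided restriction property and `Q D (const a) = P D`, then the clause holds at the trivial
past `const a` of every Dobrushin domain `D`: its remaining domain is `D` and its tip is `a`.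
[cite: LawlerSchrammWerner2003Restriction, §1 p. 4] -/
theorem kernelClause_trivialPast {P : ChordalFamily} (hR : P.IsRestriction)
    {Q : DobrushinDomain → CurveClass ℂ → Measure (CurveClass ℂ)}
    (h0 : ∀ D : DobrushinDomain, Q D (CurveClass.mk (Curve.const (D.pt 0))) = P D)
    (D D' : DobrushinDomain)
    (hsub : D'.carrier ⊆ remainingDomain D (CurveClass.mk (Curve.const (D.pt 0))))
    (hpt0 : D'.pt 0 = (CurveClass.mk (Curve.const (D.pt 0))).target) (hpt1 : D'.pt 1 = D.pt 1)
    (T : Set (CurveClass ℂ)) (hT : MeasurableSet T) :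
    P D' T * Q D (CurveClass.mk (Curve.const (D.pt 0))) (CurveClass.rangeSubset (closure D'.carrier)) =
      Q D (CurveClass.mk (Curve.const (D.pt 0))) (T ∩ CurveClass.rangeSubset (closure D'.carrier)) := by
  rw [remainingDomain_mk_const] at hsub
  have hpt0' : D'.pt 0 = D.pt 0 := by simpa [Curve.target_def] using hpt0
  rw [h0 D]
  exact hR D D' hsub hpt0' hpt1 T hT

/-- **Bookkeeping theorem: an a.e. kernel clause upgrades to `IsRestrictionMarkov`.** Let `P` have
the two-sided restriction property (conjunct (i)) and let `Q` be a domain-Markov extension of `P`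
(`initial`, `markov` for every closed `F`, `domain`). If for every Dobrushin domain `D` and every
closed `F ⊆ ℂ` the restriction-kernel clause holds at the past `γ.stopAt F` for `P D`-a.e. `γ` —
i.e. for every Dobrushin `D' ⊆ remainingDomain D (γ.stopAt F)` pinned at the tip and at `D.pt 1`,
`P D' T · Q D (γ.stopAt F) {⊆ D̄'} = Q D (γ.stopAt F) (T ∩ {⊆ D̄'})` — then `P` is restriction-Markov:
the kernel `Q'` equal to `Q` where the clause holds and to `0` elsewhere is again a Markov extension
(the clause and `Q` are configuration-determined, the trivial past satisfies the clause by (i), the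
modified pasts are null for every `(D, F)`) and is a restriction kernel everywhere. [folklore] -/
theorem isRestrictionMarkov_of_ae_kernelClause {P : ChordalFamily} (hR : P.IsRestriction)
    {Q : DobrushinDomain → CurveClass ℂ → Measure (CurveClass ℂ)} (hQ : P.IsMarkovExtension Q)
    (hae : ∀ (D : DobrushinDomain) (F : Set ℂ), IsClosed F → ∀ᵐ γ ∂(P D),
      ∀ D' : DobrushinDomain, D'.carrier ⊆ remainingDomain D (γ.stopAt F) →
        D'.pt 0 = (γ.stopAt F).target → D'.pt 1 = D.pt 1 →
          ∀ T : Set (CurveClass ℂ), MeasurableSet T →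
            P D' T * Q D (γ.stopAt F) (CurveClass.rangeSubset (closure D'.carrier)) =
              Q D (γ.stopAt F) (T ∩ CurveClass.rangeSubset (closure D'.carrier))) :
    P.IsRestrictionMarkov := by
  classical
  -- the clause at the configuration of `(D, p)`
  set KC : DobrushinDomain → CurveClass ℂ → Prop := fun D p =>
    ∀ D' : DobrushinDomain, D'.carrier ⊆ remainingDomain D p → D'.pt 0 = p.target →
      D'.pt 1 = D.pt 1 → ∀ T : Set (CurveClass ℂ), MeasurableSet T →
        P D' T * Q D p (CurveClass.rangeSubset (closure D'.carrier)) =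
          Q D p (T ∩ CurveClass.rangeSubset (closure D'.carrier)) with hKC
  -- the modified kernel
  let Q' : DobrushinDomain → CurveClass ℂ → Measure (CurveClass ℂ) := fun D p =>
    if KC D p then Q D p else 0
  have hQ'pos : ∀ D p, KC D p → Q' D p = Q D p := fun D p h => if_pos h
  have hQ'neg : ∀ D p, ¬ KC D p → Q' D p = 0 := fun D p h => if_neg h
  -- the clause holds at the trivial past, by restriction (i)
  have htriv : ∀ D : DobrushinDomain, KC D (CurveClass.mk (Curve.const (D.pt 0))) := by
    intro D D' hsub hpt0 hpt1 T hT
    exact kernelClause_trivialPast hR hQ.initial D D' hsub hpt0 hpt1 T hT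
  refine ⟨Q', ⟨fun D => ?_, fun D F hF S T hS hT => ?_, fun D₁ D₂ p₁ p₂ h1 h2 h3 => ?_⟩, ?_⟩
  · -- initial
    rw [hQ'pos D _ (htriv D)]
    exact hQ.initial D
  · -- markov: the integrands agree almost everywhere
    rw [hQ.markov D F hF S T hS hT]
    refine lintegral_congr_ae (ae_restrict_of_ae ?_)
    filter_upwards [hae D F hF] with γ hγ
    rw [hQ'pos D _ hγ]
  · -- domain: the clause and the kernel are configuration-determined
    have hq : Q D₁ p₁ = Q D₂ p₂ := hQ.domain D₁ D₂ p₁ p₂ h1 h2 h3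
    have hiff : KC D₁ p₁ ↔ KC D₂ p₂ := by
      simp only [hKC, h1, h2, h3, hq]
    by_cases h : KC D₁ p₁
    · rw [hQ'pos D₁ p₁ h, hQ'pos D₂ p₂ (hiff.1 h), hq]
    · rw [hQ'neg D₁ p₁ h, hQ'neg D₂ p₂ fun h' => h (hiff.2 h')]
  · -- the clause, everywhere
    intro D p D' hsub hpt0 hpt1 T hT
    by_cases h : KC D p
    · rw [hQ'pos D p h]
      exact h D' hsub hpt0 hpt1 T hT
    · rw [hQ'neg D p h]
      simp

/-! ### Registered sub-goal of crux stmt-CriticalPhenomena-1370 (line `registered`, stub `stub_markovOfLimit`) -/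

/-- **Registered sub-goal `stub_isRestrictionMarkovOfAEKernelClause`** (crux stmt-CriticalPhenomena-1370, lead c5):
the bookkeeping theorem `isRestrictionMarkov_of_ae_kernelClause`, notation-free. [folklore] -/
theorem stub_isRestrictionMarkovOfAEKernelClause : ∀ (P : Literature.Probability.RandomPlanarGeometry.ChordalFamily), P.IsRestriction → ∀ (Q : Literature.Probability.RandomPlanarGeometry.DobrushinDomain → Literature.Probability.RandomPlanarGeometry.CurveClass ℂ → MeasureTheory.Measure (Literature.Probability.RandomPlanarGeometry.CurveClass ℂ)), P.IsMarkovExtension Q → (∀ (D : Literature.Probability.RandomPlanarGeometry.DobrushinDomain) (F : Set ℂ), IsClosed F → Filter.Eventually (fun γ : Literature.Probability.RandomPlanarGeometry.CurveClass ℂ => ∀ D' : Literature.Probability.RandomPlanarGeometry.DobrushinDomain, D'.carrier ⊆ Literature.Probability.RandomPlanarGeometry.remainingDomain D (γ.stopAt F) → D'.pt 0 = (γ.stopAt F).target → D'.pt 1 = D.pt 1 → ∀ T : Set (Literature.Probability.RandomPlanarGeometry.CurveClass ℂ), MeasurableSet T → P D' T * Q D (γ.stopAt F) (Literature.Probability.RandomPlanarGeometry.CurveClass.rangeSubset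 (closure D'.carrier)) = Q D (γ.stopAt F) (T ∩ Literature.Probability.RandomPlanarGeometry.CurveClass.rangeSubset (closure D'.carrier))) (MeasureTheory.ae (P D))) → P.IsRestrictionMarkov :=
  fun _P hR _Q hQ hae => isRestrictionMarkov_of_ae_kernelClause hR hQ hae

end Summit.CriticalPhenomena.SAWScalingLimit.Theorems.AxiomsOfLimitKernelClause

end
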